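import Literature.NumberTheory.Irrationality.Fischler2002.Theoreme32OrderThreeProofs
import HarnessLib

/-!
# Fischler 2002, Théorème 3.2 — `n = 3`: the sixteen linear forms and the AFFINE action of `⟨σ, ψ, φ⟩` on them

Topic `Literature/NumberTheory/Irrationality/Fischler2002`. PROOFS ONLY (no definition, no statement). Brick toward the `n = 3` case of
the named fact `theoreme32` (`RhinViolaGroupsGeneral.lean`). Under the dictionary of `Theoreme32ThreeDictionaryProofs.lean`
(`𝒥₃ =` Rhin–Viola's `I(h,j,k,l,m,q,r,s)`, `(h,…,s) = (b₁,a₃,a₂,a₁,a₂+b₃−c₃,b₃,b₁+b₃−c₃,b₂)`), Rhin–Viola's SIXTEEN integers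
`h,…,s,h',…,s'` [RhinViola2001, (2.7)–(2.8)] are sixteen linear forms on `𝓔₃`, PERMUTED by the group `G = ⟨σ, ψ, φ⟩ ≅ H ⋊ 𝔖₅` of
Théorème 3.2 (`n = 3`) [Fischler2003RhinViola, §3.4 Th. 6: "`H` est l'hyperplan `ε₁+⋯+ε₅ = 0` de `(ℤ/2ℤ)⁵`"]. This file makes the
semidirect structure explicit and kernel-enumerable: the forms are indexed by the EVEN subsets of `Fin 5` (5-bit codes `c : Fin 32`;
odd codes carry the form `0`), and every `g ∈ G` acts through an AFFINE map `c ↦ s·c + t` (`s ∈ 𝔖₅` permuting the five bits, `t` an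
even code added bitwise): `F_c(g·p) = F_{s·c+t}(p)`. Generators: `σ ↦ ((0 4)(2 3), t = 12)`, `ψ ↦ ((0 2)(3 4), t = 29)`,
`φ ↦ ((1 2), 0)`; the words `χ₃ := ψφσφσφσψ ↦ ((2 3), 0)` (acting as the typed `chi 3` on `𝓔₃`) and
`ϑ̃ := φσφσψσφσφσψσφ ↦ ((0 2 3 4), t = 6)` (acting as Rhin–Viola's `ϑ`, cf. `Jn_three_theta`). Codes of the eight PARAMETER forms
(`h,j,k,l,m,q,r,s`): `0, 6, 12, 30, 29, 27, 17, 3`. Contents: bits and composition law of the affine maps (`testBit_A`, `A_comp`), the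
relation «`g` acts through `(s,t)`» for the generators (`aff_sigma/psi/phi`: 32-entry tables checked by `decide`), products and inverses
(`aff_mul_A`, `aff_inv_A`), existence for every `g ∈ G` with `t` even (`exists_aff_of_mem`), determination of `g` by `(s,t)`
(`eq_of_aff`), and the words with their live coordinates (`aff_chiWord`, `chiWord_coords`, `aff_thetaWord`, `thetaWord_coords`). The forms
`F` and the action `A` ride on FREE function symbols with defining tables (no definition), as in the order bricks. Cell `pub-zeta5`,
seat ct-1 g34, 2026-08-28. [cite: Fischler2002Polyzetas, §3 Théorème 3.2 (n = 3)] [cite: RhinViola2001, §4 p. 282 (1 → (ℤ/2)⁴ → Φ → S₅ → 1)]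

HONEST FRAMING (cell pub-zeta5): systematic search; no irrationality claim — finite bookkeeping of a printed group; nothing about `ζ(5)`.
-/


namespace Literature.NumberTheory.Irrationality.Fischler2002

namespace Theoreme32

open Equiv

section ThreeForms

variable {F : Fin 32 → Exponents → ℤ}
  (hF : ∀ (c : Fin 32) (p : Exponents), F c p =
    ![p.b 1, 0, 0, p.b 2, 0, p.a 2 + p.b 2 - p.c 3, p.a 3, 0, 0, p.a 2 + p.b 3 - p.a 1, p.c 3, 0, p.a 2, 0, 0,
      p.a 2 + p.b 2 - p.b 1, 0, p.b 1 + p.b 3 - p.c 3, p.a 1 + p.b 1 - p.a 2, 0, p.a 1 + p.b 1 - p.c 3, 0, 0,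
      p.a 3 + p.b 3 - p.c 3, p.a 1 + p.b 1 - p.a 3, 0, 0, p.b 3, 0, p.a 2 + p.b 3 - p.c 3, p.a 1, 0] c)
  {A : Perm (Fin 5) → Fin 32 → Fin 32 → Fin 32}
  (hA : ∀ (s : Perm (Fin 5)) (t c : Fin 32), A s t c = Fin.ofNat 32
    ((if (Nat.testBit c.val (s.symm 0).val != Nat.testBit t.val 0) then 1 else 0) +
      (if (Nat.testBit c.val (s.symm 1).val != Nat.testBit t.val 1) then 2 else 0) +
      (if (Nat.testBit c.val (s.symm 2).val != Nat.testBit t.val 2) then 4 else 0) +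
      (if (Nat.testBit c.val (s.symm 3).val != Nat.testBit t.val 3) then 8 else 0) +
      (if (Nat.testBit c.val (s.symm 4).val != Nat.testBit t.val 4) then 16 else 0)))
  {gσ gψ gφ : Perm {p : Exponents // InE 3 p}}

/-! ### The affine maps on 5-bit codes: bits, identity, composition, inverses -/

/-- The five bits of a 5-bit sum of indicators. [folklore] -/
private theorem testBit_code (b : Fin 5 → Bool) (i : Fin 5) :
    Nat.testBit (Fin.ofNat 32 ((if b 0 then 1 else 0) + (if b 1 then 2 else 0) + (if b 2 then 4 else 0) +
      (if b 3 then 8 else 0) + (if b 4 then 16 else 0))).val i.val = b i := by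
  revert b i; decide

include hA in
/-- **Bit description of the action:** bit `i` of `s·c + t` is bit `s⁻¹(i)` of `c` XOR bit `i` of `t`.
[cite: Fischler2002Polyzetas, §3 Théorème 3.2 (n = 3: G ≅ H ⋊ 𝔖₅)] -/
theorem testBit_A (s : Perm (Fin 5)) (t c : Fin 32) (i : Fin 5) :
    Nat.testBit (A s t c).val i.val = (Nat.testBit c.val (s.symm i).val != Nat.testBit t.val i.val) := by
  rw [hA]
  exact testBit_code (fun j => Nat.testBit c.val (s.symm j).val != Nat.testBit t.val j.val) i

/-- Two 5-bit codes with the same five bits are equal. [folklore] -/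
private theorem eq_of_testBit_eq {x y : Fin 32} (h : ∀ i : Fin 5, Nat.testBit x.val i.val = Nat.testBit y.val i.val) : x = y := by
  have key : ∀ x y : Fin 32, ((List.finRange 5).all fun i => Nat.testBit x.val i.val == Nat.testBit y.val i.val) = true → x = y := by
    decide
  exact key x y (by simpa [List.all_eq_true] using h)

include hA in
/-- The identity: `1·c + 0 = c` (the unit of `H ⋊ 𝔖₅`). [cite: Fischler2002Polyzetas, §3 Théorème 3.2 (n = 3: G ≅ H ⋊ 𝔖₅)] -/
theorem A_one (c : Fin 32) : A 1 0 c = c :=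
  eq_of_testBit_eq fun i => by
    have e1 : (1 : Perm (Fin 5)).symm i = i := rfl
    rw [testBit_A hA, e1, Fin.val_zero, Nat.zero_testBit]
    cases Nat.testBit c.val i.val <;> rfl

include hA in
/-- **Composition law** of the affine maps: `s'·(s·c + t) + t' = (s's)·c + (s'·t + t')`.
[cite: Fischler2002Polyzetas, §3 Théorème 3.2 (n = 3: G ≅ H ⋊ 𝔖₅)] -/
theorem A_comp (s s' : Perm (Fin 5)) (t t' c : Fin 32) : A s' t' (A s t c) = A (s' * s) (A s' t' t) c :=
  eq_of_testBit_eq fun i => by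
    have e1 : (s' * s).symm i = s.symm (s'.symm i) := rfl
    simp only [testBit_A hA, e1]
    cases Nat.testBit c.val (s.symm (s'.symm i)).val <;> cases Nat.testBit t.val (s'.symm i).val <;>
      cases Nat.testBit t'.val i.val <;> rfl

include hA in
/-- Left inverse in `H ⋊ 𝔖₅`: `s⁻¹·((s·c + t)) + s⁻¹·t = c`. [cite: Fischler2002Polyzetas, §3 Théorème 3.2 (n = 3: G ≅ H ⋊ 𝔖₅)] -/
theorem A_inv_left (s : Perm (Fin 5)) (t c : Fin 32) : A s⁻¹ (A s⁻¹ 0 t) (A s t c) = c :=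
  eq_of_testBit_eq fun i => by
    have e1 : s⁻¹.symm i = s i := rfl
    simp only [testBit_A hA, e1, Equiv.symm_apply_apply, Fin.val_zero, Nat.zero_testBit]
    cases Nat.testBit c.val i.val <;> cases Nat.testBit t.val (s i).val <;> rfl

include hA in
/-- Right inverse in `H ⋊ 𝔖₅`: `s·(s⁻¹·c + s⁻¹·t) + t = c`. [cite: Fischler2002Polyzetas, §3 Théorème 3.2 (n = 3: G ≅ H ⋊ 𝔖₅)] -/
theorem A_inv_right (s : Perm (Fin 5)) (t c : Fin 32) : A s t (A s⁻¹ (A s⁻¹ 0 t) c) = c :=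
  eq_of_testBit_eq fun i => by
    have e1 : ∀ j, s⁻¹.symm j = s j := fun j => rfl
    simp only [testBit_A hA, e1, Equiv.apply_symm_apply, Fin.val_zero, Nat.zero_testBit]
    cases Nat.testBit c.val i.val <;> cases Nat.testBit t.val i.val <;> rfl

/-! ### The relation «`g` acts on the forms through `(s, t)`»: products and inverses -/

/-- Products (an anti-homomorphism in `s`). [cite: Fischler2002Polyzetas, §3 Théorème 3.2 (n = 3)] -/
theorem aff_mul {g h : Perm {p : Exponents // InE 3 p}} {π τ : Fin 32 → Fin 32}
    (hg : ∀ c p, F c (g p).1 = F (π c) p.1) (hh : ∀ c p, F c (h p).1 = F (τ c) p.1) :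
    ∀ c p, F c ((g * h) p).1 = F (τ (π c)) p.1 := by
  intro c p
  rw [Perm.mul_apply, hg, hh]

include hA in
/-- Products of affine data: `(s,t)` then `(s',t')` compose to `(s's, s'·t + t')`. [cite: Fischler2002Polyzetas, §3 Théorème 3.2 (n = 3)] -/
theorem aff_mul_A {g h : Perm {p : Exponents // InE 3 p}} {s s' : Perm (Fin 5)} {t t' : Fin 32}
    (hg : ∀ c p, F c (g p).1 = F (A s t c) p.1) (hh : ∀ c p, F c (h p).1 = F (A s' t' c) p.1) :
    ∀ c p, F c ((g * h) p).1 = F (A (s' * s) (A s' t' t) c) p.1 := by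
  intro c p
  rw [aff_mul hg hh, A_comp hA]

include hA in
/-- Inverses. [cite: Fischler2002Polyzetas, §3 Théorème 3.2 (n = 3)] -/
theorem aff_inv_A {g : Perm {p : Exponents // InE 3 p}} {s : Perm (Fin 5)} {t : Fin 32}
    (hg : ∀ c p, F c (g p).1 = F (A s t c) p.1) :
    ∀ c p, F c (g⁻¹ p).1 = F (A s⁻¹ (A s⁻¹ 0 t) c) p.1 := by
  intro c p
  have h := hg (A s⁻¹ (A s⁻¹ 0 t) c) (g⁻¹ p)
  rw [A_inv_right hA, ← Perm.mul_apply, mul_inv_cancel, Perm.one_apply] at h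
  exact h.symm

/-- Transport of the relation «`g` acts through `π`» along an equality of data. [cite: Fischler2002Polyzetas, §3 Théorème 3.2 (n = 3)] -/
theorem aff_congr {g : Perm {p : Exponents // InE 3 p}} {π τ : Fin 32 → Fin 32}
    (hg : ∀ c p, F c (g p).1 = F (π c) p.1) (h : ∀ c, π c = τ c) : ∀ c p, F c (g p).1 = F (τ c) p.1 := by
  intro c p; rw [hg, h]

/-! ### The generators -/

include hF hA in
/-- `σ` acts on the sixteen forms through `((0 4)(2 3), t = {2,3} = 12)`. [cite: Fischler2002Polyzetas, §3 Théorème 3.2 (n = 3)] -/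
theorem aff_sigma (hσ : ∀ p, (gσ p).1 = sigma p.1) (c : Fin 32) (p : {p : Exponents // InE 3 p}) :
    F c (gσ p).1 = F (A (swap 0 4 * swap 2 3) 12 c) p.1 := by
  have hT : ∀ c, A (swap 0 4 * swap 2 3) 12 c =
      ![12, 28, 14, 30, 4, 20, 6, 22, 8, 24, 10, 26, 0, 16, 2, 18, 13, 29, 15, 31, 5, 21, 7, 23, 9, 25, 11, 27, 1, 17, 3, 19] c := by
    intro c; rw [hA]; revert c; decide
  obtain ⟨-, h3, -⟩ := p.2
  have e := h3 rfl
  rw [hσ p, hT]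
  fin_cases c <;> simp [hF, sigma] <;> omega

include hF hA in
/-- `ψ` acts on the sixteen forms through `((0 2)(3 4), t = {0,2,3,4} = 29)`. [cite: Fischler2002Polyzetas, §3 Théorème 3.2 (n = 3)] -/
theorem aff_psi (hψ : ∀ p, (gψ p).1 = psi 3 p.1) (c : Fin 32) (p : {p : Exponents // InE 3 p}) :
    F c (gψ p).1 = F (A (swap 0 2 * swap 3 4) 29 c) p.1 := by
  have hT : ∀ c, A (swap 0 2 * swap 3 4) 29 c =
      ![29, 25, 31, 27, 28, 24, 30, 26, 13, 9, 15, 11, 12, 8, 14, 10, 21, 17, 23, 19, 20, 16, 22, 18, 5, 1, 7, 3, 4, 0, 6, 2] c := by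
    intro c; rw [hA]; revert c; decide
  obtain ⟨-, h3, -⟩ := p.2
  have e := h3 rfl
  rw [hψ p, hT]
  fin_cases c <;> simp [hF, psi] <;> omega

include hF hA in
/-- `φ` acts on the sixteen forms through the transposition `(1 2)` (no translation). [cite: Fischler2002Polyzetas, §3 Théorème 3.2 (n = 3)] -/
theorem aff_phi (hφ : ∀ p, (gφ p).1 = phi 3 p.1) (c : Fin 32) (p : {p : Exponents // InE 3 p}) :
    F c (gφ p).1 = F (A (swap 1 2) 0 c) p.1 := by
  have hT : ∀ c, A (swap 1 2) 0 c =
      ![0, 1, 4, 5, 2, 3, 6, 7, 8, 9, 12, 13, 10, 11, 14, 15, 16, 17, 20, 21, 18, 19, 22, 23, 24, 25, 28, 29, 26, 27, 30, 31] c := by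
    intro c; rw [hA]; revert c; decide
  obtain ⟨-, h3, -⟩ := p.2
  have e := h3 rfl
  rw [hφ p, hT]
  fin_cases c <;> simp [hF, phi] <;> omega

/-! ### Every element of `⟨σ', ψ', φ'⟩` acts through some `(s, t)` with `t` even -/

include hA in
/-- Composition keeps the translation part EVEN (codes `0,3,5,6,9,10,12,15,17,18,20,23,24,27,29,30`).
[cite: Fischler2002Polyzetas, §3 Théorème 3.2 (n = 3: H = the even hyperplane)] -/
theorem A_even (s : Perm (Fin 5)) {t t' : Fin 32}
    (ht : t ∈ [(0 : Fin 32), 3, 5, 6, 9, 10, 12, 15, 17, 18, 20, 23, 24, 27, 29, 30])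
    (ht' : t' ∈ [(0 : Fin 32), 3, 5, 6, 9, 10, 12, 15, 17, 18, 20, 23, 24, 27, 29, 30]) :
    A s t' t ∈ [(0 : Fin 32), 3, 5, 6, 9, 10, 12, 15, 17, 18, 20, 23, 24, 27, 29, 30] := by
  have hfun := funext fun s => funext fun t => funext fun c => hA s t c
  subst hfun
  revert s t t'
  decide +kernel

include hF hA in
/-- **Every `g ∈ ⟨σ', ψ', φ'⟩` acts on the sixteen forms through an affine map `(s, t)` with `t` even** (closure induction).
[cite: Fischler2002Polyzetas, §3 Théorème 3.2 (n = 3: G ≅ H ⋊ 𝔖₅)] -/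
theorem exists_aff_of_mem (hσ : ∀ p, (gσ p).1 = sigma p.1) (hψ : ∀ p, (gψ p).1 = psi 3 p.1)
    (hφ : ∀ p, (gφ p).1 = phi 3 p.1) {g : Perm {p : Exponents // InE 3 p}}
    (hg : g ∈ Subgroup.closure ({gσ, gψ, gφ} : Set (Perm {p : Exponents // InE 3 p}))) :
    ∃ (s : Perm (Fin 5)) (t : Fin 32), t ∈ [(0 : Fin 32), 3, 5, 6, 9, 10, 12, 15, 17, 18, 20, 23, 24, 27, 29, 30] ∧
      ∀ c p, F c (g p).1 = F (A s t c) p.1 := by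
  induction hg using Subgroup.closure_induction with
  | mem x hx =>
    simp only [Set.mem_insert_iff, Set.mem_singleton_iff] at hx
    rcases hx with rfl | rfl | rfl
    · exact ⟨_, 12, by simp, aff_sigma hF hA hσ⟩
    · exact ⟨_, 29, by simp, aff_psi hF hA hψ⟩
    · exact ⟨_, 0, by simp, aff_phi hF hA hφ⟩
  | one => exact ⟨1, 0, by simp, fun c p => by rw [A_one hA]; rfl⟩
  | mul x y _ _ ihx ihy =>
    obtain ⟨s, t, ht, hx⟩ := ihx
    obtain ⟨s', t', ht', hy⟩ := ihy
    exact ⟨s' * s, A s' t' t, A_even hA s' ht ht', aff_mul_A hA hx hy⟩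
  | inv x _ ihx =>
    obtain ⟨s, t, ht, hx⟩ := ihx
    exact ⟨s⁻¹, A s⁻¹ 0 t, A_even hA s⁻¹ ht (by simp), aff_inv_A hA hx⟩

/-! ### The sixteen forms (and the inert coordinates) determine the point -/

include hF in
/-- **Two elements of `⟨σ', ψ', φ'⟩` acting through the same map of the forms are equal** (the live coordinates
`a₁,a₂,a₃,b₁,b₂,b₃,c₃` are among the forms — codes `30,12,6,0,3,27,10` —, `c₂ = 0` on `𝓔₃`, and the other coordinates are inert).
[cite: Fischler2002Polyzetas, §3 Théorème 3.2 (n = 3)] -/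
theorem eq_of_aff (hσ : ∀ p, (gσ p).1 = sigma p.1) (hψ : ∀ p, (gψ p).1 = psi 3 p.1) (hφ : ∀ p, (gφ p).1 = phi 3 p.1)
    {g h : Perm {p : Exponents // InE 3 p}} {π : Fin 32 → Fin 32}
    (hg : g ∈ Subgroup.closure ({gσ, gψ, gφ} : Set (Perm {p : Exponents // InE 3 p})))
    (hh : h ∈ Subgroup.closure ({gσ, gψ, gφ} : Set (Perm {p : Exponents // InE 3 p})))
    (hgπ : ∀ c p, F c (g p).1 = F (π c) p.1) (hhπ : ∀ c p, F c (h p).1 = F (π c) p.1) : g = h := by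
  have ext' : ∀ {x y : Exponents}, (∀ k, x.a k = y.a k) → (∀ k, x.b k = y.b k) → (∀ k, x.c k = y.c k) → x = y := by
    intro x y ha hb hc
    cases x; cases y
    simp only [Exponents.mk.injEq]
    exact ⟨funext ha, funext hb, funext hc⟩
  refine Equiv.ext fun p => Subtype.ext ?_
  obtain ⟨iga, igb, igc⟩ := inert3_of_mem hσ hψ hφ hg p
  obtain ⟨iha, ihb, ihc⟩ := inert3_of_mem hσ hψ hφ hh p
  have eq : ∀ c, F c (g p).1 = F c (h p).1 := fun c => by rw [hgπ, hhπ]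
  have e30 := eq 30; have e12 := eq 12; have e6 := eq 6; have e0 := eq 0; have e3 := eq 3; have e27 := eq 27
  have e10 := eq 10
  simp only [hF] at e30 e12 e6 e0 e3 e27 e10
  simp at e30 e12 e6 e0 e3 e27 e10
  have cg := (g p).2.1 2 le_rfl (by norm_num)
  have ch := (h p).2.1 2 le_rfl (by norm_num)
  refine ext' (fun k => ?_) (fun k => ?_) (fun k => ?_)
  · by_cases h1 : k = 1
    · subst h1; exact e30
    by_cases h2 : k = 2
    · subst h2; exact e12
    by_cases h3 : k = 3
    · subst h3; exact e6
    rw [iga k h1 h2 h3, iha k h1 h2 h3]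
  · by_cases h1 : k = 1
    · subst h1; exact e0
    by_cases h2 : k = 2
    · subst h2; exact e3
    by_cases h3 : k = 3
    · subst h3; exact e27
    rw [igb k h1 h2 h3, ihb k h1 h2 h3]
  · by_cases h2 : k = 2
    · subst h2; rw [cg, ch]
    by_cases h3 : k = 3
    · subst h3; exact e10
    rw [igc k h2 h3, ihc k h2 h3]

/-! ### The words `χ₃ = ψφσφσφσψ` and `ϑ̃ = φσφσψσφσφσψσφ` -/

include hF hA in
/-- **The word `χ₃ = ψφσφσφσψ` acts through the transposition `(2 3)`** (Rhin–Viola's `χ`, Euler's exchange in `z = x₃`).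
[cite: Fischler2002Polyzetas, §3 p. 3 (definition of χ)] [cite: RhinViola2001, §4 p. 281 (χ)] -/
theorem aff_chiWord (hσ : ∀ p, (gσ p).1 = sigma p.1) (hψ : ∀ p, (gψ p).1 = psi 3 p.1) (hφ : ∀ p, (gφ p).1 = phi 3 p.1)
    (c : Fin 32) (p : {p : Exponents // InE 3 p}) :
    F c ((gψ * gφ * gσ * gφ * gσ * gφ * gσ * gψ) p).1 = F (A (swap 2 3) 0 c) p.1 := by
  have hS := aff_sigma hF hA hσ; have hP := aff_psi hF hA hψ; have hΦ := aff_phi hF hA hφ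
  have h2 := aff_congr (aff_mul_A hA hP hΦ) (τ := A (swap 0 1 * swap 1 2 * swap 3 4) 27) (fun c => by
    rw [show (swap 1 2 * (swap 0 2 * swap 3 4) : Perm (Fin 5)) = swap 0 1 * swap 1 2 * swap 3 4 from by decide,
      show A (swap 1 2) 0 (29 : Fin 32) = 27 from by rw [hA]; decide])
  have h3 := aff_congr (aff_mul_A hA h2 hS) (τ := A (swap 0 1 * swap 1 3 * swap 2 4) 27) (fun c => by
    rw [show (swap 0 4 * swap 2 3 * (swap 0 1 * swap 1 2 * swap 3 4) : Perm (Fin 5)) = swap 0 1 * swap 1 3 * swap 2 4 from by decide,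
      show A (swap 0 4 * swap 2 3) 12 (27 : Fin 32) = 27 from by rw [hA]; decide])
  have h4 := aff_congr (aff_mul_A hA h3 hΦ) (τ := A (swap 0 2 * swap 2 4 * swap 4 1 * swap 1 3) 29) (fun c => by
    rw [show (swap 1 2 * (swap 0 1 * swap 1 3 * swap 2 4) : Perm (Fin 5)) = swap 0 2 * swap 2 4 * swap 4 1 * swap 1 3 from by decide,
      show A (swap 1 2) 0 (27 : Fin 32) = 29 from by rw [hA]; decide])
  have h5 := aff_congr (aff_mul_A hA h4 hS) (τ := A (swap 0 3 * swap 3 4 * swap 4 1 * swap 1 2) 17) (fun c => by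
    rw [show (swap 0 4 * swap 2 3 * (swap 0 2 * swap 2 4 * swap 4 1 * swap 1 3) : Perm (Fin 5)) = swap 0 3 * swap 3 4 * swap 4 1 * swap 1 2 from by decide,
      show A (swap 0 4 * swap 2 3) 12 (29 : Fin 32) = 17 from by rw [hA]; decide])
  have h6 := aff_congr (aff_mul_A hA h5 hΦ) (τ := A (swap 0 3 * swap 3 4 * swap 4 2) 17) (fun c => by
    rw [show (swap 1 2 * (swap 0 3 * swap 3 4 * swap 4 1 * swap 1 2) : Perm (Fin 5)) = swap 0 3 * swap 3 4 * swap 4 2 from by decide,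
      show A (swap 1 2) 0 (17 : Fin 32) = 17 from by rw [hA]; decide])
  have h7 := aff_congr (aff_mul_A hA h6 hS) (τ := A (swap 0 2 * swap 2 4 * swap 4 3) 29) (fun c => by
    rw [show (swap 0 4 * swap 2 3 * (swap 0 3 * swap 3 4 * swap 4 2) : Perm (Fin 5)) = swap 0 2 * swap 2 4 * swap 4 3 from by decide,
      show A (swap 0 4 * swap 2 3) 12 (17 : Fin 32) = 29 from by rw [hA]; decide])
  have h8 := aff_congr (aff_mul_A hA h7 hP) (τ := A (swap 2 3) 0) (fun c => by
    rw [show (swap 0 2 * swap 3 4 * (swap 0 2 * swap 2 4 * swap 4 3) : Perm (Fin 5)) = swap 2 3 from by decide,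
      show A (swap 0 2 * swap 3 4) 29 (29 : Fin 32) = 0 from by rw [hA]; decide])
  exact h8 c p

include hF hA in
/-- The live coordinates of `χ₃·p`: `(a₁, a₂, c₃ ; b₁, b₂, a₃+b₃−c₃ ; c₃' = a₃)` — exactly the typed `chi 3` — and `c₂ = 0`.
[cite: Fischler2002Polyzetas, §3 p. 3 (definition of χ)] -/
theorem chiWord_coords (hσ : ∀ p, (gσ p).1 = sigma p.1) (hψ : ∀ p, (gψ p).1 = psi 3 p.1) (hφ : ∀ p, (gφ p).1 = phi 3 p.1)
    (p : {p : Exponents // InE 3 p}) :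
    ((gψ * gφ * gσ * gφ * gσ * gφ * gσ * gψ) p).1.a 1 = p.1.a 1 ∧ ((gψ * gφ * gσ * gφ * gσ * gφ * gσ * gψ) p).1.a 2 = p.1.a 2 ∧
    ((gψ * gφ * gσ * gφ * gσ * gφ * gσ * gψ) p).1.a 3 = p.1.c 3 ∧ ((gψ * gφ * gσ * gφ * gσ * gφ * gσ * gψ) p).1.b 1 = p.1.b 1 ∧
    ((gψ * gφ * gσ * gφ * gσ * gφ * gσ * gψ) p).1.b 2 = p.1.b 2 ∧
    ((gψ * gφ * gσ * gφ * gσ * gφ * gσ * gψ) p).1.b 3 = p.1.a 3 + p.1.b 3 - p.1.c 3 ∧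
    ((gψ * gφ * gσ * gφ * gσ * gφ * gσ * gψ) p).1.c 3 = p.1.a 3 := by
  have h := aff_chiWord hF hA hσ hψ hφ
  have hT : ∀ c, A (swap 2 3) 0 c =
      ![0, 1, 2, 3, 8, 9, 10, 11, 4, 5, 6, 7, 12, 13, 14, 15, 16, 17, 18, 19, 24, 25, 26, 27, 20, 21, 22, 23, 28, 29, 30, 31] c := by
    intro c; rw [hA]; revert c; decide
  refine ⟨?_, ?_, ?_, ?_, ?_, ?_, ?_⟩
  · have e := h 30 p; rw [hT] at e; simpa [hF] using e
  · have e := h 12 p; rw [hT] at e; simpa [hF] using e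
  · have e := h 6 p; rw [hT] at e; simpa [hF] using e
  · have e := h 0 p; rw [hT] at e; simpa [hF] using e
  · have e := h 3 p; rw [hT] at e; simpa [hF] using e
  · have e := h 27 p; rw [hT] at e; simpa [hF] using e
  · have e := h 10 p; rw [hT] at e; simpa [hF] using e

include hF hA in
/-- **The word `ϑ̃ = φσφσψσφσφσψσφ` acts through `((0 2 3 4), t = {1,2} = 6)`** — Rhin–Viola's `ϑ = (h j k l m q r s)` on the
parameters. [cite: RhinViola2001, §2 p. 272 (ϑ)] [cite: Fischler2002Polyzetas, §3 Théorème 3.2 (n = 3)] -/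
theorem aff_thetaWord (hσ : ∀ p, (gσ p).1 = sigma p.1) (hψ : ∀ p, (gψ p).1 = psi 3 p.1) (hφ : ∀ p, (gφ p).1 = phi 3 p.1)
    (c : Fin 32) (p : {p : Exponents // InE 3 p}) :
    F c ((gφ * gσ * gφ * gσ * gψ * gσ * gφ * gσ * gφ * gσ * gψ * gσ * gφ) p).1 =
      F (A (swap 0 2 * swap 2 3 * swap 3 4) 6 c) p.1 := by
  have hS := aff_sigma hF hA hσ; have hP := aff_psi hF hA hψ; have hΦ := aff_phi hF hA hφ
  have h2 := aff_congr (aff_mul_A hA hΦ hS) (τ := A (swap 0 4 * swap 1 3 * swap 3 2) 12) (fun c => by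
    rw [show (swap 0 4 * swap 2 3 * (swap 1 2) : Perm (Fin 5)) = swap 0 4 * swap 1 3 * swap 3 2 from by decide,
      show A (swap 0 4 * swap 2 3) 12 (0 : Fin 32) = 12 from by rw [hA]; decide])
  have h3 := aff_congr (aff_mul_A hA h2 hΦ) (τ := A (swap 0 4 * swap 1 3) 10) (fun c => by
    rw [show (swap 1 2 * (swap 0 4 * swap 1 3 * swap 3 2) : Perm (Fin 5)) = swap 0 4 * swap 1 3 from by decide,
      show A (swap 1 2) 0 (12 : Fin 32) = 10 from by rw [hA]; decide])
  have h4 := aff_congr (aff_mul_A hA h3 hS) (τ := A (swap 1 2 * swap 2 3) 10) (fun c => by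
    rw [show (swap 0 4 * swap 2 3 * (swap 0 4 * swap 1 3) : Perm (Fin 5)) = swap 1 2 * swap 2 3 from by decide,
      show A (swap 0 4 * swap 2 3) 12 (10 : Fin 32) = 10 from by rw [hA]; decide])
  have h5 := aff_congr (aff_mul_A hA h4 hP) (τ := A (swap 0 2 * swap 2 4 * swap 4 3 * swap 3 1) 15) (fun c => by
    rw [show (swap 0 2 * swap 3 4 * (swap 1 2 * swap 2 3) : Perm (Fin 5)) = swap 0 2 * swap 2 4 * swap 4 3 * swap 3 1 from by decide,
      show A (swap 0 2 * swap 3 4) 29 (10 : Fin 32) = 15 from by rw [hA]; decide])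
  have h6 := aff_congr (aff_mul_A hA h5 hS) (τ := A (swap 0 3 * swap 3 1 * swap 1 4 * swap 4 2) 18) (fun c => by
    rw [show (swap 0 4 * swap 2 3 * (swap 0 2 * swap 2 4 * swap 4 3 * swap 3 1) : Perm (Fin 5)) = swap 0 3 * swap 3 1 * swap 1 4 * swap 4 2 from by decide,
      show A (swap 0 4 * swap 2 3) 12 (15 : Fin 32) = 18 from by rw [hA]; decide])
  have h7 := aff_congr (aff_mul_A hA h6 hΦ) (τ := A (swap 0 3 * swap 3 2 * swap 1 4) 20) (fun c => by
    rw [show (swap 1 2 * (swap 0 3 * swap 3 1 * swap 1 4 * swap 4 2) : Perm (Fin 5)) = swap 0 3 * swap 3 2 * swap 1 4 from by decide,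
      show A (swap 1 2) 0 (18 : Fin 32) = 20 from by rw [hA]; decide])
  have h8 := aff_congr (aff_mul_A hA h7 hS) (τ := A (swap 0 2 * swap 2 4 * swap 4 1) 5) (fun c => by
    rw [show (swap 0 4 * swap 2 3 * (swap 0 3 * swap 3 2 * swap 1 4) : Perm (Fin 5)) = swap 0 2 * swap 2 4 * swap 4 1 from by decide,
      show A (swap 0 4 * swap 2 3) 12 (20 : Fin 32) = 5 from by rw [hA]; decide])
  have h9 := aff_congr (aff_mul_A hA h8 hΦ) (τ := A (swap 0 1 * swap 2 4) 3) (fun c => by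
    rw [show (swap 1 2 * (swap 0 2 * swap 2 4 * swap 4 1) : Perm (Fin 5)) = swap 0 1 * swap 2 4 from by decide,
      show A (swap 1 2) 0 (5 : Fin 32) = 3 from by rw [hA]; decide])
  have h10 := aff_congr (aff_mul_A hA h9 hS) (τ := A (swap 0 1 * swap 1 4 * swap 4 3 * swap 3 2) 30) (fun c => by
    rw [show (swap 0 4 * swap 2 3 * (swap 0 1 * swap 2 4) : Perm (Fin 5)) = swap 0 1 * swap 1 4 * swap 4 3 * swap 3 2 from by decide,
      show A (swap 0 4 * swap 2 3) 12 (3 : Fin 32) = 30 from by rw [hA]; decide])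
  have h11 := aff_congr (aff_mul_A hA h10 hP) (τ := A (swap 0 1 * swap 1 3) 6) (fun c => by
    rw [show (swap 0 2 * swap 3 4 * (swap 0 1 * swap 1 4 * swap 4 3 * swap 3 2) : Perm (Fin 5)) = swap 0 1 * swap 1 3 from by decide,
      show A (swap 0 2 * swap 3 4) 29 (30 : Fin 32) = 6 from by rw [hA]; decide])
  have h12 := aff_congr (aff_mul_A hA h11 hS) (τ := A (swap 0 1 * swap 1 2 * swap 2 3 * swap 3 4) 6) (fun c => by
    rw [show (swap 0 4 * swap 2 3 * (swap 0 1 * swap 1 3) : Perm (Fin 5)) = swap 0 1 * swap 1 2 * swap 2 3 * swap 3 4 from by decide,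
      show A (swap 0 4 * swap 2 3) 12 (6 : Fin 32) = 6 from by rw [hA]; decide])
  have h13 := aff_congr (aff_mul_A hA h12 hΦ) (τ := A (swap 0 2 * swap 2 3 * swap 3 4) 6) (fun c => by
    rw [show (swap 1 2 * (swap 0 1 * swap 1 2 * swap 2 3 * swap 3 4) : Perm (Fin 5)) = swap 0 2 * swap 2 3 * swap 3 4 from by decide,
      show A (swap 1 2) 0 (6 : Fin 32) = 6 from by rw [hA]; decide])
  exact h13 c p

include hF hA in
/-- The live coordinates of `ϑ̃·p`: `(a₂+b₃−c₃, a₁, a₂ ; a₃, b₁, b₁+b₃−c₃ ; c₃' = a₁+b₁−c₃ = a₃+b₁+b₃−b₂−c₃)` — Rhin–Viola's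
`ϑ` under the dictionary (cf. `Jn_three_theta`). [cite: RhinViola2001, §2 p. 272 (ϑ = (h j k l m q r s))] -/
theorem thetaWord_coords (hσ : ∀ p, (gσ p).1 = sigma p.1) (hψ : ∀ p, (gψ p).1 = psi 3 p.1) (hφ : ∀ p, (gφ p).1 = phi 3 p.1)
    (p : {p : Exponents // InE 3 p}) :
    ((gφ * gσ * gφ * gσ * gψ * gσ * gφ * gσ * gφ * gσ * gψ * gσ * gφ) p).1.a 1 = p.1.a 2 + p.1.b 3 - p.1.c 3 ∧
    ((gφ * gσ * gφ * gσ * gψ * gσ * gφ * gσ * gφ * gσ * gψ * gσ * gφ) p).1.a 2 = p.1.a 1 ∧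
    ((gφ * gσ * gφ * gσ * gψ * gσ * gφ * gσ * gφ * gσ * gψ * gσ * gφ) p).1.a 3 = p.1.a 2 ∧
    ((gφ * gσ * gφ * gσ * gψ * gσ * gφ * gσ * gφ * gσ * gψ * gσ * gφ) p).1.b 1 = p.1.a 3 ∧
    ((gφ * gσ * gφ * gσ * gψ * gσ * gφ * gσ * gφ * gσ * gψ * gσ * gφ) p).1.b 2 = p.1.b 1 ∧
    ((gφ * gσ * gφ * gσ * gψ * gσ * gφ * gσ * gφ * gσ * gψ * gσ * gφ) p).1.b 3 = p.1.b 1 + p.1.b 3 - p.1.c 3 ∧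
    ((gφ * gσ * gφ * gσ * gψ * gσ * gφ * gσ * gφ * gσ * gψ * gσ * gφ) p).1.c 3 = p.1.a 3 + p.1.b 1 + p.1.b 3 - p.1.b 2 - p.1.c 3 := by
  have h := aff_thetaWord hF hA hσ hψ hφ
  have hT : ∀ c, A (swap 0 2 * swap 2 3 * swap 3 4) 6 c =
      ![6, 2, 4, 0, 14, 10, 12, 8, 22, 18, 20, 16, 30, 26, 28, 24, 7, 3, 5, 1, 15, 11, 13, 9, 23, 19, 21, 17, 31, 27, 29, 25] c := by
    intro c; rw [hA]; revert c; decide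
  obtain ⟨-, h3, -⟩ := p.2
  have e := h3 rfl
  refine ⟨?_, ?_, ?_, ?_, ?_, ?_, ?_⟩
  · have e := h 30 p; rw [hT] at e; simpa [hF] using e
  · have e := h 12 p; rw [hT] at e; simpa [hF] using e
  · have e := h 6 p; rw [hT] at e; simpa [hF] using e
  · have e := h 0 p; rw [hT] at e; simpa [hF] using e
  · have e := h 3 p; rw [hT] at e; simpa [hF] using e
  · have e := h 27 p; rw [hT] at e; simpa [hF] using e
  · have e10 := h 10 p
    rw [hT] at e10
    simp only [hF] at e10
    simp at e10
    simp only [Perm.mul_apply] at e10 ⊢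
    omega

end ThreeForms

end Theoreme32

end Literature.NumberTheory.Irrationality.Fischler2002
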